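import Literature.NumberTheory.Automorphic.BrandtModuleResidueInvolution
import HarnessLib

/-!
# Maximal orders: left orders of two-sided ideals, idempotent lifting, and the residual
# split / ramified structures

Sixth layer of the proof files for the named fact `brandtMatrix_comm` of `BrandtModule.lean`
(Vignéras, LNM 800, III §5 ex. 5.8; Eichler 1973, II §6 Thm. 2). This file isolates the only way
maximality of an order `O₁` enters the residual classification of `O₁ / p O₁`, states the two
target structures, and provides the lifting of idempotents modulo `p²`:

* **(M1)** `IsMaximalZOrder.mem_of_mul_le` — if `𝔄` is a lattice with `p O₁ ⊆ 𝔄 ⊆ O₁` and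
  `O₁ 𝔄 ⊆ 𝔄`, then every `y ∈ B` with `y 𝔄 ⊆ 𝔄` lies in `O₁`: the left order `O_ℓ(𝔄)` is an
  order (Voight Lemma 10.2.7, tree `Brandt.isOrder_leftOrder`) containing `O₁`, hence equal to it
  (Vignéras I §4: "l'ordre à gauche d'un idéal bilatère d'un ordre maximal est cet ordre").
* **Idempotent lifting** `IsZOrder.exists_lift_idempotent_sq` — if `x² ≡ x (mod p O)` then
  `E = 3x² − 2x³ ≡ x (mod p O)` and `E² ≡ E (mod p² O)` (the classical formula:
  `E² − E = (x² − x)² (4x² − 4x − 3)`).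
* The **residual structures** of an order at a prime, as predicates with bodies:
  `IsZOrder.IsResiduallySplit hO p` — matrix units `e, u, v, f = 1 − e` modulo `p O` spanning
  `O / p O` (so `O / p O ≅ M₂(𝔽_p)`; Vignéras II §2: `O_p ≅ M₂(ℤ_p)` read mod `p`); and
  `IsZOrder.IsResiduallyRamified hO p` — a two-sided lattice `𝔓` with `p O ⊆ 𝔓 ⊆ O`,
  `𝔓² = p O`, `[O : 𝔓] = p²` and `O / 𝔓` a division ring (Vignéras II §1: the unique maximal
  order of the local division algebra, `P² = p O`, `O/P ≅ 𝔽_{p²}`, read mod `p`).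

The classification theorem "a maximal order is residually split or residually ramified at every
prime" is proved in `BrandtModuleResidueSplit.lean` / `BrandtModuleResidueRamified.lean`.

## References

* M.-F. Vignéras, *Arithmétique des algèbres de quaternions*, LNM 800 (1980), Ch. I §4,
  Ch. II §§1–2 [VignerasLNM800].
* J. Voight, *Quaternion Algebras*, GTM 288 (2021), Lemma 10.2.7 [Voight2021].
-/

noncomputable section

open scoped Pointwise

universe u

namespace Literature.NumberTheory.Automorphic

/-! ### (M1): left orders of two-sided ideals of a maximal order -/

section M1

variable {B : Type u} [Ring B] [IsAddTorsionFree B] {O₁ : Submodule ℤ B}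

/-- The left order of a full lattice is a `ℤ`-order (Voight Lemma 10.2.7; the tree's
`Brandt.isOrder_leftOrder` in the `IsZOrder` vocabulary). [cite: Voight2021, Lemma 10.2.7] -/
theorem isZOrder_leftOrderOf {I : Submodule ℤ B} (hI : IsFullLattice B I) : IsZOrder (leftOrderOf I) :=
  let h := Brandt.isOrder_leftOrder (D := B) hI
  ⟨h.one_mem, h.mul_mem, h.isFullLattice⟩

omit [IsAddTorsionFree B] in
/-- A lattice squeezed between `m • O₁` (`m ≠ 0`) and `O₁` is a full lattice. [folklore] -/
theorem isFullLattice_of_smul_le (hO₁ : IsZOrder O₁) {𝔄 : Submodule ℤ B} {m : ℤ} (hm : m ≠ 0)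
    (hlow : m • O₁ ≤ 𝔄) (hup : 𝔄 ≤ O₁) : IsFullLattice B 𝔄 := by
  refine ⟨Submodule.FG.of_le hO₁.isFullLattice.1 hup, fun d => ?_⟩
  obtain ⟨k, hk, hkd⟩ := hO₁.isFullLattice.2 d
  refine ⟨m * k, mul_ne_zero hm hk, hlow ?_⟩
  rw [mul_smul]
  exact Submodule.smul_mem_pointwise_smul _ m O₁ hkd

/-- **(M1) — the left order of a two-sided ideal of a maximal order is that order** (Vignéras
I §4; here: `𝔄` a lattice with `m O₁ ⊆ 𝔄 ⊆ O₁`, `m ≠ 0`, and `O₁ 𝔄 ⊆ 𝔄`): every `y` with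
`y 𝔄 ⊆ 𝔄` lies in `O₁`. This is the only use of maximality in the residual classification. [cite: VignerasLNM800, Ch. I §4 Déf. p. 20 (ordre maximal)] -/
theorem IsMaximalZOrder.mem_of_mul_le (hmax : IsMaximalZOrder O₁) {𝔄 : Submodule ℤ B} {m : ℤ}
    (hm : m ≠ 0) (hlow : m • O₁ ≤ 𝔄) (hup : 𝔄 ≤ O₁) (hleft : ∀ x ∈ O₁, ∀ a ∈ 𝔄, x * a ∈ 𝔄)
    {y : B} (hy : ∀ a ∈ 𝔄, y * a ∈ 𝔄) : y ∈ O₁ := by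
  have hfull := isFullLattice_of_smul_le hmax.1 hm hlow hup
  have hord := isZOrder_leftOrderOf hfull
  have hle : O₁ ≤ leftOrderOf 𝔄 := fun x hx a ha => hleft x hx a ha
  have heq : leftOrderOf 𝔄 = O₁ := hmax.2 _ hord hle
  rw [← heq]
  exact hy

end M1

/-! ### Lifting idempotents modulo `p²` -/

namespace IsZOrder

section Lift

variable {B : Type u} [Ring B] {O : Submodule ℤ B}

/-- The classical identity behind idempotent lifting: `E² − E = (x² − x)² (4x² − 4x − 3)` for
`E = 3x² − 2x³`, in any ring. [folklore] -/
theorem lift_identity (x : B) :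
    (3 * x ^ 2 - 2 * x ^ 3) * (3 * x ^ 2 - 2 * x ^ 3) - (3 * x ^ 2 - 2 * x ^ 3) =
      (x ^ 2 - x) * (x ^ 2 - x) * (4 * x ^ 2 - 4 * x - 3) := by
  noncomm_ring

/-- `E − x = (1 − 2x)(x² − x)` for `E = 3x² − 2x³`. [folklore] -/
theorem lift_sub (x : B) : (3 * x ^ 2 - 2 * x ^ 3) - x = (1 - 2 * x) * (x ^ 2 - x) := by
  noncomm_ring

/-- **Lifting an idempotent modulo `p` to an idempotent modulo `p²`**: if `x ∈ O` has
`x² − x ∈ p O` then `E = 3x² − 2x³ ∈ O` satisfies `E − x ∈ p O` and `E² − E ∈ p² O`. [folklore] -/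
theorem exists_lift_idempotent_sq (hO : IsZOrder O) (p : ℤ) {x : B} (hx : x ∈ O)
    (hxx : x * x - x ∈ p • O) :
    ∃ E ∈ O, E - x ∈ p • O ∧ E * E - E ∈ (p * p) • O := by
  have hx2 : x ^ 2 ∈ O := by rw [pow_two]; exact hO.mul_mem _ hx _ hx
  have hx3 : x ^ 3 ∈ O := by rw [pow_succ]; exact hO.mul_mem _ hx2 _ hx
  have hq : x ^ 2 - x ∈ p • O := by rwa [pow_two]
  refine ⟨3 * x ^ 2 - 2 * x ^ 3, ?_, ?_, ?_⟩
  · refine O.sub_mem ?_ ?_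
    · rw [show (3 : B) * x ^ 2 = (3 : ℤ) • x ^ 2 by rw [zsmul_eq_mul]; norm_cast]
      exact O.smul_mem _ hx2
    · rw [show (2 : B) * x ^ 3 = (2 : ℤ) • x ^ 3 by rw [zsmul_eq_mul]; norm_cast]
      exact O.smul_mem _ hx3
  · rw [lift_sub]
    refine hO.mul_smul_mem (O.sub_mem hO.one_mem ?_) hq
    rw [show (2 : B) * x = (2 : ℤ) • x by rw [zsmul_eq_mul]; norm_cast]
    exact O.smul_mem _ hx
  · rw [lift_identity]
    refine hO.smul_mul_mem (hO.smul_mul_smul_mem hq hq) (O.sub_mem (O.sub_mem ?_ ?_) ?_)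
    · rw [show (4 : B) * x ^ 2 = (4 : ℤ) • x ^ 2 by rw [zsmul_eq_mul]; norm_cast]
      exact O.smul_mem _ hx2
    · rw [show (4 : B) * x = (4 : ℤ) • x by rw [zsmul_eq_mul]; norm_cast]
      exact O.smul_mem _ hx
    · rw [show (3 : B) = (3 : ℤ) • (1 : B) by rw [zsmul_eq_mul, mul_one]; norm_cast]
      exact O.smul_mem _ hO.one_mem

/-- For a lifted idempotent `E` (`E² − E ∈ p² O`): `E (1 − E) ∈ p² O` and `(1 − E) E ∈ p² O`. [folklore] -/
theorem lift_mul_compl {p : ℤ} {E : B} (hE : E * E - E ∈ (p * p) • O) :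
    E * (1 - E) ∈ (p * p) • O ∧ (1 - E) * E ∈ (p * p) • O := by
  have h1 : E * (1 - E) = -(E * E - E) := by noncomm_ring
  have h2 : (1 - E) * E = -(E * E - E) := by noncomm_ring
  rw [h1, h2]
  exact ⟨Submodule.neg_mem _ hE, Submodule.neg_mem _ hE⟩

end Lift

/-! ### The residual structures -/

section Structures

variable {B : Type u} [Ring B] {O : Submodule ℤ B}

/-- **`O` is residually split at `p`**: there are `e, u, v ∈ O` which, with `f = 1 − e`, are
matrix units modulo `p O` (`e² ≡ e`, `eu ≡ u`, `ue ≡ 0`, `u² ≡ 0`, `v² ≡ 0`, `ev ≡ 0`,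
`ve ≡ v`, `uv ≡ e`, `vu ≡ f`) and span `O` modulo `p O` — i.e. `O / p O ≅ M₂(ℤ/p)` with
`e ↦ E₁₁`, `u ↦ E₁₂`, `v ↦ E₂₁`, `f ↦ E₂₂` (the residual form of Vignéras II §2 Thm. 2.3:
`O_p` is conjugate to `M₂(ℤ_p)` at a split prime). [cite: VignerasLNM800, Ch. II §2 Thm. 2.3] -/
def IsResiduallySplit (_hO : IsZOrder O) (p : ℕ) : Prop :=
  ∃ e u v : B, e ∈ O ∧ u ∈ O ∧ v ∈ O ∧
    e * e - e ∈ (p : ℤ) • O ∧ e * u - u ∈ (p : ℤ) • O ∧ u * e ∈ (p : ℤ) • O ∧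
    u * u ∈ (p : ℤ) • O ∧ v * v ∈ (p : ℤ) • O ∧ e * v ∈ (p : ℤ) • O ∧
    v * e - v ∈ (p : ℤ) • O ∧ u * v - e ∈ (p : ℤ) • O ∧ v * u - (1 - e) ∈ (p : ℤ) • O ∧
    ∀ x ∈ O, ∃ a b c d : ℤ, x - (a • e + b • u + c • v + d • (1 - e)) ∈ (p : ℤ) • O

/-- **`O` is residually ramified at `p`**: there is a two-sided lattice `𝔓` with
`p O ⊆ 𝔓 ⊆ O`, `𝔓² = p O`, `[O : 𝔓] = p²`, and `O / 𝔓` a division ring (every `x ∈ O ∖ 𝔓`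
is invertible modulo `𝔓`) — the residual form of Vignéras II §1 (Thm. 1.1 ff.: the maximal
order of the local division algebra has a unique maximal two-sided ideal `P = O π`, `P² = O p`,
`O / P ≅ 𝔽_{p²}`). [cite: VignerasLNM800, Ch. II §1 (P² = Op, O/P corps à p² éléments)] -/
def IsResiduallyRamified (_hO : IsZOrder O) (p : ℕ) : Prop :=
  ∃ P : Submodule ℤ B, (p : ℤ) • O ≤ P ∧ P ≤ O ∧ O * P ≤ P ∧ P * O ≤ P ∧
    P * P = (p : ℤ) • O ∧ P.toAddSubgroup.relIndex O.toAddSubgroup = p ^ 2 ∧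
    ∀ x ∈ O, x ∉ P → ∃ w ∈ O, x * w - 1 ∈ P ∧ w * x - 1 ∈ P

end Structures

end IsZOrder

end Literature.NumberTheory.Automorphic

end
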